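import Literature.Barriers.AtomisticToContinuum.HardDiskTranslationInvarianceSteps
import Literature.Analysis.FunctionSpaces.PoissonMeckeCylinders
import HarnessLib

/-!
# A factor-two criterion for translation invariance of measures on planar configurations
# (the extremal-decomposition-free variant of Richthammer 2007, Lemma 5)

Companion of `HardDiskTranslationInvarianceSteps.lean` (provefact
`Literature.Barriers.AtomisticToContinuum.HardDisk.Richthammer2007_hardDisk`). Richthammer's
Lemma 5 [Richthammer2007, §3.5; proof §4.3 = Georgii Prop. 9.1] turns the Mermin–Wagner estimate
`μ(D + τ̂) + μ(D - τ̂) ≥ μ(D)` (all cylinder events `D`, all Gibbs measures `μ`) into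
`τ̂`-invariance of every Gibbs measure through the extremal decomposition of Gibbs measures, which
needs the configuration space to be standard Borel. This file proves an elementary substitute that
works one measure at a time, at the price of a factor two in the hypothesis — the factor that the
estimates of [Richthammer2007, §5–6] deliver anyway (Lemma 12 there gives
`log φ̄ + log φ ≥ -1` on the good set, and `≥ -η` for any `η > 0` by the same argument, whence
`φ̄ + φ ≥ 2e^{-η/2}` by the arithmetic-geometric inequality):

* `generateFrom_cylinderEvents`, `isPiSystem_cylinderEvents`, `measure_ext_of_cylinderEvents` —
  the cylinder events `⋃_m 𝓕_{𝒳,Λ_m}` form a π-system generating the count σ-algebra (each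
  `N(s)` is the eventual value of `N(s ∩ Λ_m)`, `PointConfig.count_eq_natCast_iff_eventually`), so
  finite measures of equal mass agreeing on them coincide ("by the monotone class theorem this
  inequality even holds on all of `𝓕_𝒳`", [Richthammer2007, §4.3]);
* `apply_add_eq_of_two_mul_le`, `apply_eq_apply_zero_of_periodic` — a real function bounded above
  with `2g(x) ≤ g(x + t) + g(x - t)` for all `x` is `t`-periodic (its increments along `x + ℕt` are
  non-decreasing), and `t`-periodicity for all `t ∈ ]0, 1/2]` forces a constant;
* `measure_preimage_translate_eq_of_two_mul_le`, `map_translate_eq_of_two_mul_le`,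
  `map_translate_eq_of_two_mul_le_coord` — **the criterion**: a finite measure `μ` with
  `2μ(D) ≤ μ(D - te) + μ(D + te)` for all cylinder `D` and `t ∈ [0, 1/2]` is invariant under the
  translations `ℝe`; with both coordinate directions, under all of `ℝ²`.

## References

* [Richthammer2007] T. Richthammer, *Translation-invariance of two-dimensional Gibbsian point
  processes*, Comm. Math. Phys. 274 (2007) 81–122, arXiv:0706.3637: §3.5 Lemma 5, §4.3, §5.5,
  §6.7 Lemma 12.
-/

noncomputable section

open MeasureTheory Set
open scoped ENNReal

namespace Literature.Barriers.AtomisticToContinuum.HardDisk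

open Literature.Analysis.FunctionSpaces

/-! ### Cylinder events generate the count σ-algebra and form a π-system -/

/-- The local events form a π-system (an increasing union of σ-algebras). [folklore] -/
theorem isPiSystem_cylinderEvents :
    IsPiSystem (⋃ m : ℕ, {D : Set (PointConfig (EuclideanSpace ℝ (Fin 2))) | IsCylinderEvent (box m) D}) := by
  refine isPiSystem_iUnion_of_monotone (fun m : ℕ => {D : Set (PointConfig (EuclideanSpace ℝ (Fin 2))) | IsCylinderEvent (box m) D})
    (fun m => ?_) ?_
  · exact @MeasurableSpace.isPiSystem_measurableSet _
      (MeasurableSpace.comap (PointConfig.restrict (box (m : ℝ))) inferInstance)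
  · intro m m' h D hD
    exact IsCylinderEvent.mono (measurableSet_box _) (box_mono (by exact_mod_cast h)) hD

/-- Counting events of a window are cylinder events of that window:
`{N(s ∩ Λ_m) = k} ∈ 𝓕_{𝒳,Λ_m}`. [folklore] -/
theorem isCylinderEvent_count_inter_box {s : Set (EuclideanSpace ℝ (Fin 2))} (hs : MeasurableSet s) (m : ℕ) (k : ℕ∞) :
    IsCylinderEvent (box m) {c : PointConfig (EuclideanSpace ℝ (Fin 2)) | c.count (s ∩ box m) = k} := by
  refine isCylinderEvent_iff.2 ⟨{c : PointConfig (EuclideanSpace ℝ (Fin 2)) | c.count (s ∩ box m) = k},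
    PointConfig.measurable_count (hs.inter (measurableSet_box _)) (measurableSet_singleton k), ?_⟩
  ext c
  simp only [Set.mem_preimage, Set.mem_setOf_eq, PointConfig.count_restrict]
  rw [← Set.inter_assoc, Set.inter_comm (box (m : ℝ)) s, Set.inter_assoc, Set.inter_self]

/-- **The cylinder events generate the count σ-algebra** `𝓕_𝒳` (every counting variable `N(s)`
is the monotone limit of the local ones `N(s ∩ Λ_m)`). [folklore] -/
theorem generateFrom_cylinderEvents :
    MeasurableSpace.generateFrom
        (⋃ m : ℕ, {D : Set (PointConfig (EuclideanSpace ℝ (Fin 2))) | IsCylinderEvent (box m) D}) =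
      (inferInstance : MeasurableSpace (PointConfig (EuclideanSpace ℝ (Fin 2)))) := by
  apply le_antisymm
  · refine MeasurableSpace.generateFrom_le fun D hD => ?_
    obtain ⟨m, hm⟩ := Set.mem_iUnion.1 hD
    exact hm.measurableSet (measurableSet_box _)
  · have hmono : Monotone fun m : ℕ => box (m : ℝ) := fun m m' h => box_mono (by exact_mod_cast h)
    have hU : (⋃ m : ℕ, box (m : ℝ)) = Set.univ :=
      Set.eq_univ_of_forall fun x => Set.mem_iUnion.2 (exists_mem_box x)
    have hcount : ∀ s : Set (EuclideanSpace ℝ (Fin 2)), MeasurableSet s →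
        Measurable[MeasurableSpace.generateFrom
          (⋃ m : ℕ, {D : Set (PointConfig (EuclideanSpace ℝ (Fin 2))) | IsCylinderEvent (box m) D})]
          fun c : PointConfig (EuclideanSpace ℝ (Fin 2)) => c.count s := by
      intro s hs
      have hnat : ∀ k : ℕ, MeasurableSet[MeasurableSpace.generateFrom
          (⋃ m : ℕ, {D : Set (PointConfig (EuclideanSpace ℝ (Fin 2))) | IsCylinderEvent (box m) D})]
          {c : PointConfig (EuclideanSpace ℝ (Fin 2)) | c.count s = k} := by
        intro k
        have hset : {c : PointConfig (EuclideanSpace ℝ (Fin 2)) | c.count s = k} =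
            ⋃ N : ℕ, ⋂ m : ℕ, ⋂ (_ : N ≤ m), {c : PointConfig (EuclideanSpace ℝ (Fin 2)) | c.count (s ∩ box m) = k} := by
          ext c
          simp only [Set.mem_setOf_eq, Set.mem_iUnion, Set.mem_iInter]
          exact PointConfig.count_eq_natCast_iff_eventually c s hmono hU k
        rw [hset]
        refine MeasurableSet.iUnion fun N => MeasurableSet.iInter fun m => MeasurableSet.iInter fun _ => ?_
        exact MeasurableSpace.measurableSet_generateFrom
          (Set.mem_iUnion.2 ⟨m, isCylinderEvent_count_inter_box hs m k⟩)
      refine @measurable_to_countable' ℕ∞ (PointConfig (EuclideanSpace ℝ (Fin 2))) _ _ (MeasurableSpace.generateFrom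
        (⋃ m : ℕ, {D : Set (PointConfig (EuclideanSpace ℝ (Fin 2))) | IsCylinderEvent (box m) D})) _
        fun y => ?_
      induction y using ENat.recTopCoe with
      | top =>
        have hset : (fun c : PointConfig (EuclideanSpace ℝ (Fin 2)) => c.count s) ⁻¹' {⊤} =
            (⋃ k : ℕ, {c : PointConfig (EuclideanSpace ℝ (Fin 2)) | c.count s = k})ᶜ := by
          ext c
          simp only [Set.mem_preimage, Set.mem_singleton_iff, Set.mem_compl_iff, Set.mem_iUnion,
            Set.mem_setOf_eq, not_exists]
          constructor
          · intro h k hk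
            rw [hk] at h
            exact ENat.coe_ne_top k h
          · intro h
            by_contra hne
            obtain ⟨k, hk⟩ := ENat.ne_top_iff_exists.1 hne
            exact h k hk.symm
        rw [hset]
        exact (MeasurableSet.iUnion hnat).compl
      | coe k => exact hnat k
    change (⨆ (s : Set (EuclideanSpace ℝ (Fin 2))) (_ : MeasurableSet s),
        (⊤ : MeasurableSpace ℕ∞).comap fun c : PointConfig (EuclideanSpace ℝ (Fin 2)) => c.count s) ≤ _
    exact iSup₂_le fun s hs => (hcount s hs).comap_le

/-- Two finite measures on configurations with the same mass that agree on cylinder events are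
equal. [folklore] -/
theorem measure_ext_of_cylinderEvents {μ ν : Measure (PointConfig (EuclideanSpace ℝ (Fin 2)))} [IsFiniteMeasure μ]
    (h : ∀ (m : ℕ) (D : Set (PointConfig (EuclideanSpace ℝ (Fin 2)))), IsCylinderEvent (box m) D → μ D = ν D)
    (huniv : μ Set.univ = ν Set.univ) : μ = ν :=
  ext_of_generate_finite _ generateFrom_cylinderEvents.symm isPiSystem_cylinderEvents
    (fun D hD => by
      obtain ⟨m, hm⟩ := Set.mem_iUnion.1 hD
      exact h m D hm)
    huniv

/-! ### Midpoint-convex bounded functions along an arithmetic progression -/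

/-- If `2 g(x) ≤ g(x + t) + g(x - t)` for all `x` and `g` is bounded above, then `g(x + t) ≤ g(x)`:
the increments of `g` along `x + ℕt` are non-decreasing, so a positive first increment would make
`g` unbounded. [folklore] -/
theorem apply_add_le_of_two_mul_le {g : ℝ → ℝ} {t C : ℝ}
    (hmid : ∀ x, 2 * g x ≤ g (x + t) + g (x - t)) (hC : ∀ x, g x ≤ C) (x : ℝ) :
    g (x + t) ≤ g x := by
  refine le_of_not_gt fun hlt => ?_
  set d : ℝ := g (x + t) - g x with hd
  have hdpos : 0 < d := by linarith
  have hinc : ∀ k : ℕ, d ≤ g (x + (k + 1) * t) - g (x + k * t) := by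
    intro k
    induction k with
    | zero => simp [hd]
    | succ k ih =>
      have hk := hmid (x + (k + 1) * t)
      have e1 : x + (k + 1 : ℝ) * t + t = x + ((k + 1 : ℕ) + 1 : ℝ) * t := by push_cast; ring
      have e2 : x + (k + 1 : ℝ) * t - t = x + (k : ℝ) * t := by ring
      rw [e1, e2] at hk
      push_cast at ih hk ⊢
      linarith
  have hsum : ∀ n : ℕ, g x + n * d ≤ g (x + n * t) := by
    intro n
    induction n with
    | zero => simp
    | succ n ih =>
      have := hinc n
      push_cast at this ⊢
      linarith
  obtain ⟨n, hn⟩ := exists_nat_gt ((C - g x) / d)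
  rw [div_lt_iff₀ hdpos] at hn
  linarith [hsum n, hC (x + n * t)]

/-- Under the same hypotheses `g` is `t`-periodic. [folklore] -/
theorem apply_add_eq_of_two_mul_le {g : ℝ → ℝ} {t C : ℝ}
    (hmid : ∀ x, 2 * g x ≤ g (x + t) + g (x - t)) (hC : ∀ x, g x ≤ C) (x : ℝ) :
    g (x + t) = g x := by
  refine le_antisymm (apply_add_le_of_two_mul_le hmid hC x) ?_
  have h := apply_add_le_of_two_mul_le (g := fun y => g (-y)) (t := t) (C := C)
    (fun y => by
      have e1 : -(y + t) = -y - t := by ring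
      have e2 : -(y - t) = -y + t := by ring
      simp only [e1, e2]
      linarith [hmid (-y)])
    (fun y => hC _) (-x - t)
  have e3 : -(-x - t + t) = x := by ring
  have e4 : -(-x - t) = x + t := by ring
  simp only [e3, e4] at h
  exact h

/-- A `t`-periodic function for every period `t ∈ ]0, 1/2]` is constant. [folklore] -/
theorem apply_eq_apply_zero_of_periodic {g : ℝ → ℝ}
    (hper : ∀ t : ℝ, 0 ≤ t → t ≤ 1 / 2 → ∀ x, g (x + t) = g x) (s : ℝ) : g s = g 0 := by
  set n : ℕ := ⌈2 * |s|⌉₊ + 1 with hn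
  have hn0 : (0 : ℝ) < n := by rw [hn]; positivity
  set t : ℝ := |s| / n with ht
  have ht0 : 0 ≤ t := div_nonneg (abs_nonneg s) hn0.le
  have ht1 : t ≤ 1 / 2 := by
    rw [ht, div_le_iff₀ hn0, hn]
    push_cast
    linarith [Nat.le_ceil (2 * |s|)]
  have hstep := hper t ht0 ht1
  have hadd : ∀ (k : ℕ) (x : ℝ), g (x + k * t) = g x := by
    intro k
    induction k with
    | zero => intro x; simp
    | succ k ih =>
      intro x
      have e : x + ((k + 1 : ℕ) : ℝ) * t = x + (k : ℝ) * t + t := by push_cast; ring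
      rw [e, hstep, ih]
  have hsub : ∀ (k : ℕ) (x : ℝ), g (x - k * t) = g x := by
    intro k x
    have := hadd k (x - k * t)
    rw [sub_add_cancel] at this
    exact this.symm
  have hnt : (n : ℝ) * t = |s| := by rw [ht, mul_div_cancel₀ _ hn0.ne']
  rcases le_or_gt 0 s with hs | hs
  · have := hadd n 0
    rw [zero_add, hnt, abs_of_nonneg hs] at this
    exact this
  · have := hsub n 0
    rw [zero_sub, hnt, abs_of_neg hs, neg_neg] at this
    exact this

/-! ### The factor-two criterion (extremal decomposition not needed) -/

/-- **Translates of a cylinder event have the same mass** under a finite measure `μ` satisfying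
`2μ(D) ≤ μ(D - te) + μ(D + te)` for all cylinder events `D` and `t ∈ [0, 1/2]`: the bounded function
`s ↦ μ(D - se)` is midpoint-convex along every progression of step `t ≤ 1/2`, hence constant. [folklore] -/
theorem measure_preimage_translate_eq_of_two_mul_le {μ : Measure (PointConfig (EuclideanSpace ℝ (Fin 2)))} [IsFiniteMeasure μ]
    {e : EuclideanSpace ℝ (Fin 2)}
    (h : ∀ (m : ℕ) (D : Set (PointConfig (EuclideanSpace ℝ (Fin 2)))), IsCylinderEvent (box m) D → ∀ t : ℝ, 0 ≤ t → t ≤ 1 / 2 →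
      2 * μ D ≤ μ (PointConfig.translate (t • e) ⁻¹' D) + μ (PointConfig.translate (-(t • e)) ⁻¹' D))
    {m : ℕ} {D : Set (PointConfig (EuclideanSpace ℝ (Fin 2)))} (hD : IsCylinderEvent (box m) D) (s : ℝ) :
    μ (PointConfig.translate (s • e) ⁻¹' D) = μ D := by
  set g : ℝ → ℝ := fun s => (μ (PointConfig.translate (s • e) ⁻¹' D)).toReal with hg
  have hgC : ∀ x, g x ≤ (μ Set.univ).toReal := fun x =>
    ENNReal.toReal_mono (measure_ne_top μ _) (measure_mono (Set.subset_univ _))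
  have hmid : ∀ t, 0 ≤ t → t ≤ 1 / 2 → ∀ x, 2 * g x ≤ g (x + t) + g (x - t) := by
    intro t ht0 ht1 x
    have key := h _ _ (hD.preimage_translate_box (x • e)) t ht0 ht1
    rw [← Set.preimage_comp, ← Set.preimage_comp, PointConfig.translate_comp_translate,
      PointConfig.translate_comp_translate] at key
    have e1 : t • e + x • e = (x + t) • e := by rw [add_smul, add_comm]
    have e2 : -(t • e) + x • e = (x - t) • e := by rw [sub_smul, ← neg_add_eq_sub]
    rw [e1, e2] at key
    have key' := ENNReal.toReal_mono
      (ENNReal.add_ne_top.2 ⟨measure_ne_top μ _, measure_ne_top μ _⟩) key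
    rw [ENNReal.toReal_mul, ENNReal.toReal_add (measure_ne_top μ _) (measure_ne_top μ _)] at key'
    simpa [hg] using key'
  have hper : ∀ t : ℝ, 0 ≤ t → t ≤ 1 / 2 → ∀ x, g (x + t) = g x :=
    fun t ht0 ht1 => apply_add_eq_of_two_mul_le (hmid t ht0 ht1) hgC
  have hgs : g s = g 0 := apply_eq_apply_zero_of_periodic hper s
  have h0 : g 0 = (μ D).toReal := by
    simp only [hg, zero_smul, PointConfig.translate_zero_eq_id, Set.preimage_id]
  rw [h0] at hgs
  exact (ENNReal.toReal_eq_toReal_iff' (measure_ne_top μ _) (measure_ne_top μ _)).1 hgs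

/-- **The factor-two criterion for translation invariance.** A finite measure `μ` on planar
configurations with `2μ(D) ≤ μ(D - te) + μ(D + te)` for all cylinder events `D ∈ 𝓕_{𝒳,Λ_m}`,
`m ∈ ℕ`, and all `t ∈ [0, 1/2]` is invariant under every translation `se`, `s ∈ ℝ`. Unlike
Richthammer's Lemma 5 (factor one, all Gibbs measures at once, extremal decomposition), this
variant is measure-by-measure and elementary; the Mermin–Wagner estimates of [Richthammer2007, §5–6]
deliver the factor `2e^{-η/2}` for every `η > 0`. [folklore] -/
theorem map_translate_eq_of_two_mul_le {μ : Measure (PointConfig (EuclideanSpace ℝ (Fin 2)))} [IsFiniteMeasure μ] {e : EuclideanSpace ℝ (Fin 2)}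
    (h : ∀ (m : ℕ) (D : Set (PointConfig (EuclideanSpace ℝ (Fin 2)))), IsCylinderEvent (box m) D → ∀ t : ℝ, 0 ≤ t → t ≤ 1 / 2 →
      2 * μ D ≤ μ (PointConfig.translate (t • e) ⁻¹' D) + μ (PointConfig.translate (-(t • e)) ⁻¹' D))
    (s : ℝ) : μ.map (PointConfig.translate (s • e)) = μ := by
  refine measure_ext_of_cylinderEvents (fun m D hD => ?_) ?_
  · rw [Measure.map_apply (PointConfig.measurable_translate _) (hD.measurableSet (measurableSet_box _))]
    exact measure_preimage_translate_eq_of_two_mul_le h hD s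
  · rw [Measure.map_apply (PointConfig.measurable_translate _) MeasurableSet.univ, Set.preimage_univ]

/-- **Corollary: full translation invariance from the factor-two estimate in the two coordinate
directions.** [folklore] -/
theorem map_translate_eq_of_two_mul_le_coord {μ : Measure (PointConfig (EuclideanSpace ℝ (Fin 2)))} [IsFiniteMeasure μ]
    (h : ∀ (i : Fin 2) (m : ℕ) (D : Set (PointConfig (EuclideanSpace ℝ (Fin 2)))), IsCylinderEvent (box m) D →
      ∀ t : ℝ, 0 ≤ t → t ≤ 1 / 2 →
        2 * μ D ≤ μ (PointConfig.translate (t • EuclideanSpace.single i (1 : ℝ)) ⁻¹' D) +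
          μ (PointConfig.translate (-(t • EuclideanSpace.single i (1 : ℝ))) ⁻¹' D))
    (τ : EuclideanSpace ℝ (Fin 2)) : μ.map (PointConfig.translate τ) = μ := by
  have hτ : τ = τ 0 • EuclideanSpace.single 0 (1 : ℝ) + τ 1 • EuclideanSpace.single 1 (1 : ℝ) := by
    ext j
    fin_cases j <;> simp
  rw [hτ, ← PointConfig.translate_comp_translate,
    ← Measure.map_map (PointConfig.measurable_translate _) (PointConfig.measurable_translate _),
    map_translate_eq_of_two_mul_le (h 0), map_translate_eq_of_two_mul_le (h 1)]

end Literature.Barriers.AtomisticToContinuum.HardDisk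

end
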